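import Summits.CriticalPhenomena.SAWScalingLimit.Theorems.SAWLeftRightFKGFKGToTraversalBoundSlotCombinatorics
import Summits.CriticalPhenomena.SAWScalingLimit.Theorems.SAWLeftRightFKGFKGToTraversalBoundSlotBead
import Summits.CriticalPhenomena.SAWScalingLimit.Theorems.SAWLeftRightFKGFKGToTraversalBoundSlotEngine
import Summits.CriticalPhenomena.SAWScalingLimit.Theorems.SAWLeftRightFKGFKGToTraversalBoundWindowTransfer
import Summits.CriticalPhenomena.SAWScalingLimit.Theorems.SAWLeftRightFKGFKGToTraversalBoundDomBounded
import HarnessLib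

/-!
# Slot law (stub `stub_slotLaw : SlotLaw`, line `slit-necklace`, reshape r4)

Crux `SAWLeftRightFKG.FKGToTraversalBound` (stmt-CriticalPhenomena-1878), line `slit-necklace`, lead
prover-line-stmt-CriticalPhenomena-1878-c5-0, chart `Cruxes/FKGToTraversalBound/Lines/slit-necklace-chart-r4.md` §1;
the statement `SlotLaw` is the def of `…SlitNecklaceFarTip` (p132289).

Proof (chart r4 §1).  Take the threshold `n` of the engine `UniformSubshellTight ε (2 n₀ + 1)`.  Fix the data; let
`E` be the event of `SlotLaw` and, for a chord `γ` carrying the far-tip piece `(i, j; τ, τ')` with exactly `J`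
far-tip pieces before it, let `Sl γ` be its SLOT in index form (same prefix up to `τ`, same suffix from some
`τ'' ≥ τ`, off the spine in between).
* S1 (`…SlotCombinatorics`, p133358): the data are unique (`farTipData_unique`), every `γ ∈ E` lies in `Sl γ`, and a member
  of `Sl γ` has the transferred data `(i, ·; τ, τ'')` (`IsFarTipPiece.slot_transfer`), so `Sl z = Sl γ` for
  `z ∈ Sl γ`: the slots `{Sl γ : γ ∈ E}` are pairwise disjoint and cover `E`.
* S2/S3 (`weight_slotEvent_le`, from `…SlotBead` p133431, `…SlotEngine` p133835): `w(E ∩ Sl γ) ≤ ε · w(Sl γ)` — the slot is the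
  bead event of `necklace_beadIdentity` (p126690) for `K` = spine ∪ prefix ∪ suffix, the hung presentation
  (hypothesis `HungPresentation`) presents `Keep(p τ', K)` as an r2 carrier `dom C'' δ` with both tips
  trace-adjacent, the windows of `z ∈ E ∩ Sl γ` between its tips are windows of its middle
  (`hasSepWindows_window_iff`, p130875), a chord of `dom C'' δ`, and the engine with the far-tip witness as static
  allowance bounds their law by `ε` (`law_slotMiddle_le`).
* Sum: `w(E) ≤ Σ_T w(E ∩ T) ≤ ε Σ_T w(T) = ε · w(⋃ T) ≤ ε · Z` over the finitely many slots (`finite_domainSAW`),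
  and `law = Z⁻¹ · w`.

No literature fact; axioms are the standard three.
-/

noncomputable section

open MeasureTheory Filter Topology Set Metric
open scoped NNReal ENNReal
open Literature.Probability.LatticeModels
open Literature.Probability.RandomPlanarGeometry
open Literature.Probability.RandomPlanarGeometry.SAW
open Summit.CriticalPhenomena.SAWScalingLimit.Theorems.FKGToTraversalBound.Negative (dom)

namespace Summit.CriticalPhenomena.SAWScalingLimit.Theorems.FKGToTraversalBound.SlitNecklace

/-! ### S2/S3: the weight of the windows event inside one slot -/

/-- **One slot.**  For a chord `γ` of `Ω_δ` with a far-tip piece `(i, j; τ, τ')` off the attached spine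
`Ka ∪ Kb ∪ S` of a tame presentation `(C, S)` and a far-tip witness with fewer than `n₀ + 1` windows across
`D(y; s₁, s₂)`, `(3ρ + R)/4 + δ ≤ s₁ < s₂ ≤ (ρ + 3R)/4 - δ`: the chords in the slot of `γ` having `n` strictly
separated index windows across `D(y; ρ, R)` between `τ` and their suffix index `τ''` weigh at most `ε` times the
slot, where `n` is the engine's threshold at allowance `2 n₀ + 1` (hypothesis `hUST`, the body of
`UniformSubshellTight`).  Bead identity (`weight_slotBead_eq`) for the hung carrier `dom C'' δ` of
`HungPresentation` (its `Keep`-set rewritten by `keep_adj_iff`, its attachment by `slotK_attached`), window transfer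
to the middle (`hasSepWindows_window_iff`), engine (`law_slotMiddle_le`), product inequality
(`weight_le_ofReal_mul_weight`, `Z_{dom C'' δ} < ∞` by `weight_dom_univ_ne_top`). [folklore] -/
theorem weight_slotEvent_le (hHP : HungPresentation) {n n₀ : ℕ} {ε : ℝ}
    (hUST : ∀ (δ : ℝ) (c u v u' v' : Site 2) (C : (zdGraph 2).Walk c c),
      0 < δ → u' ∈ C.support → v' ∈ C.support → (zdGraph 2).Adj u u' → (zdGraph 2).Adj v v' →
      ∀ (x : ℂ) (ρ R : ℝ), δ ≤ ρ → 2 * ρ ≤ R →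
        (∃ γ₀ : DomainSAW (dom C δ) δ u v,
          ¬ (polyline γ₀).HasTraversals (2 * n₀ + 1 + 1) x ((3 * ρ + R) / 4) ((ρ + 3 * R) / 4)) →
        law (dom C δ) δ u v {γ | (polyline γ).HasTraversals n x ρ R} ≤ ENNReal.ofReal ε)
    {Ω : Set ℂ} {δ : ℝ} {c : Site 2} {C : (zdGraph 2).Walk c c} {S Ka Kb : Finset (Site 2)}
    {a₀ b₀ : Site 2} {ca cb : ℂ} {η : ℝ} {y : ℂ} {ρ R s₁ s₂ : ℝ} (hδ : 0 < δ)
    (hS : ∀ x' y' : Site 2, (discreteDomainGraph (dom C δ) δ).Adj x' y' ↔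
      ((discreteDomainGraph Ω δ).Adj x' y' ∧ x' ∉ S ∧ y' ∉ S))
    (hatt : ∀ k ∈ Ka ∪ Kb ∪ S, ∃ (q : Site 2) (w : (zdGraph 2).Walk k q), q ∈ C.support ∧
      ∀ z ∈ w.support, z ∈ Ka ∪ Kb ∪ S ∨ z ∈ C.support)
    (ha₀ : a₀ ∈ Ka) (hb₀ : b₀ ∈ Kb) (hρ : δ ≤ ρ) (hρR : 2 * ρ ≤ R)
    (hs₁ : (3 * ρ + R) / 4 + δ ≤ s₁) (hs₁₂ : s₁ < s₂) (hs₂ : s₂ ≤ (ρ + 3 * R) / 4 - δ)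
    {γ : DomainSAW Ω δ a₀ b₀} {i j τ τ' : ℕ}
    (hft : IsFarTipPiece (meshPoint δ) γ.walk (↑(Ka ∪ Kb ∪ S)) i j τ τ' ca cb η)
    (hwit : HasFarTipWitness Ω δ (↑(Ka ∪ Kb ∪ S)) γ.walk τ τ' (n₀ + 1) y s₁ s₂) :
    weight Ω δ a₀ b₀ {z | (∀ m, m ≤ τ → z.walk.getVert m = γ.walk.getVert m) ∧
        ∃ τ'', τ ≤ τ'' ∧ τ'' ≤ z.walk.length ∧ z.walk.length + τ' = γ.walk.length + τ'' ∧
          (∀ m, z.walk.getVert (τ'' + m) = γ.walk.getVert (τ' + m)) ∧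
          (∀ m, τ ≤ m → m ≤ τ'' → z.walk.getVert m ∉ (↑(Ka ∪ Kb ∪ S) : Set (Site 2))) ∧
          HasSepWindows (meshPoint δ) z.walk n τ τ'' y ρ R} ≤
      ENNReal.ofReal ε * weight Ω δ a₀ b₀ {z | (∀ m, m ≤ τ → z.walk.getVert m = γ.walk.getVert m) ∧
        ∃ τ'', τ ≤ τ'' ∧ τ'' ≤ z.walk.length ∧ z.walk.length + τ' = γ.walk.length + τ'' ∧
          (∀ m, z.walk.getVert (τ'' + m) = γ.walk.getVert (τ' + m)) ∧
          ∀ m, τ ≤ m → m ≤ τ'' → z.walk.getVert m ∉ (↑(Ka ∪ Kb ∪ S) : Set (Site 2))} := by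
  classical
  set Spf : Finset (Site 2) := Ka ∪ Kb ∪ S with hSpf
  set p := γ.walk with hp
  obtain ⟨⟨-, ⟨hjL, -⟩, hij, hint⟩, hiτ, hττ', hτ'j, -⟩ := hft
  have hτ'L : τ' ≤ p.length := by omega
  have hτS : p.getVert τ ∉ (↑Spf : Set (Site 2)) := hint τ hiτ (by omega)
  have hτ'S : p.getVert τ' ∉ (↑Spf : Set (Site 2)) := hint τ' (by omega) hτ'j
  have hinj := γ.isPath.getVert_injOn
  -- the obstacle set `K` = spine ∪ prefix ∪ suffix vertices
  set Kf : Finset (Site 2) :=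
    Spf ∪ ((Finset.range (p.length + 1)).filter (fun m => m < τ ∨ τ' < m)).image p.getVert with hKf
  have hK : ∀ z, z ∈ (↑Kf : Set (Site 2)) ↔
      z ∈ (↑Spf : Set (Site 2)) ∨ ∃ m, m ≤ p.length ∧ (m < τ ∨ τ' < m) ∧ p.getVert m = z := by
    intro z
    rw [Finset.mem_coe, hKf, Finset.mem_union, Finset.mem_image]
    constructor
    · rintro (h | ⟨m, hm, rfl⟩)
      · exact Or.inl h
      · rw [Finset.mem_filter, Finset.mem_range] at hm
        exact Or.inr ⟨m, by omega, hm.2, rfl⟩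
    · rintro (h | ⟨m, hmL, hm, rfl⟩)
      · exact Or.inl h
      · exact Or.inr ⟨m, Finset.mem_filter.2 ⟨Finset.mem_range.2 (by omega), hm⟩, rfl⟩
  have hKf' : ∀ z, z ∈ Kf ↔ z ∈ Spf ∨ ∃ m, m ≤ p.length ∧ (m < τ ∨ τ' < m) ∧ p.getVert m = z := hK
  have ht'K : p.getVert τ' ∉ Kf := by
    intro h
    rcases (hKf' _).1 h with h | ⟨m, hmL, hm, hmeq⟩
    · exact hτ'S h
    · have h' := hinj (show m ∈ {i | i ≤ p.length} from hmL)
        (show τ' ∈ {i | i ≤ p.length} from hτ'L) hmeq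
      omega
  -- the hung presentation of `Keep(p τ', K)`
  have ha₀' : a₀ ∈ Spf := by simp [hSpf, ha₀]
  have hb₀' : b₀ ∈ Spf := by simp [hSpf, hb₀]
  obtain ⟨c'', C'', -, hKC, hadj₀⟩ :=
    hHP δ c (p.getVert τ') C Kf hδ ht'K (slotK_attached hatt ha₀' hb₀' hKf')
  have hSK : ∀ z ∈ S, z ∈ (↑Kf : Set (Site 2)) := fun z hz => (hK z).2 (Or.inl (by simp [hSpf, hz]))
  have hadj := keep_adj_iff hS hSK hadj₀
  -- the engine on the middle
  have hlaw := law_slotMiddle_le hδ (by omega) hττ' (by omega) hK hKC hadj hUST hρ hρR hs₁ hs₁₂ hs₂ hwit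
  -- the windows event read on the vertex sequence of the middle
  let P : List (Site 2) → Prop := fun l => ∃ β' : DomainSAW (dom C'' δ) δ (p.getVert τ) (p.getVert τ'),
    β'.walk.support = l ∧ HasSepWindows (meshPoint δ) β'.walk n 0 β'.walk.length y ρ R
  have hPW : {β' : DomainSAW (dom C'' δ) δ (p.getVert τ) (p.getVert τ') | P β'.walk.support} =
      {β' | HasSepWindows (meshPoint δ) β'.walk n 0 β'.walk.length y ρ R} := by
    ext β'
    constructor
    · rintro ⟨β₂, h₂, hW₂⟩
      rw [ExcursionDomination.domainSAW_ext_support h₂] at hW₂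
      exact hW₂
    · exact fun h => ⟨β', rfl, h⟩
  have hbeadP := weight_slotBead_eq γ.isPath hττ' hτ'L hτS hτ'S hK hadj P
  have hbeadT := weight_slotBead_eq γ.isPath hττ' hτ'L hτS hτ'S hK hadj (fun _ => True)
  simp only [and_true, Set.setOf_true] at hbeadT
  rw [hPW] at hbeadP
  -- the slot is the bead event; the windows event is inside the bead event with `P`
  have hslot := Set.ext fun z => inSlot_iff_exists_bead hττ' hτ'L hK z
  have hsub : {z : DomainSAW Ω δ a₀ b₀ | (∀ m, m ≤ τ → z.walk.getVert m = p.getVert m) ∧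
      ∃ τ'', τ ≤ τ'' ∧ τ'' ≤ z.walk.length ∧ z.walk.length + τ' = p.length + τ'' ∧
        (∀ m, z.walk.getVert (τ'' + m) = p.getVert (τ' + m)) ∧
        (∀ m, τ ≤ m → m ≤ τ'' → z.walk.getVert m ∉ (↑Spf : Set (Site 2))) ∧
        HasSepWindows (meshPoint δ) z.walk n τ τ'' y ρ R} ⊆
      {z | ∃ β : (discreteDomainGraph Ω δ).Walk (p.getVert τ) (p.getVert τ'),
        z.walk = (p.take τ).append (β.append (p.drop τ')) ∧ (∀ v ∈ β.support, v ∉ (↑Kf : Set (Site 2))) ∧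
          P β.support} := by
    rintro z ⟨hpre, τ'', hτ, hτ''L, hlen, hsuf, hmid, hwin⟩
    obtain ⟨β, hz, hβK⟩ := (inSlot_iff_exists_bead hττ' hτ'L hK z).1 ⟨hpre, τ'', hτ, hτ''L, hlen, hsuf, hmid⟩
    refine ⟨β, hz, hβK, ?_⟩
    have hzpath : ((p.take τ).append (β.append (p.drop τ'))).IsPath := hz ▸ z.isPath
    have hβpath : β.IsPath := hzpath.of_append_right.of_append_left
    let β' : DomainSAW (dom C'' δ) δ (p.getVert τ) (p.getVert τ') :=
      ⟨β.transfer _ (edges_mem_edgeSet_keep hadj β hβK), hβpath.transfer _⟩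
    have hsupp : β'.walk.support = β.support := SimpleGraph.Walk.support_transfer _ _
    refine ⟨β', hsupp, ?_⟩
    -- the windows of `z` between `τ` and `τ''` are the windows of `β`
    have hβlen : β.length = τ'' - τ := by
      have h := congrArg SimpleGraph.Walk.length hz
      rw [SimpleGraph.Walk.length_append, SimpleGraph.Walk.length_append, SimpleGraph.Walk.take_length,
        SimpleGraph.Walk.drop_length, min_eq_left (hττ'.trans hτ'L)] at h
      omega
    have e₁ : p.getVert τ = z.walk.getVert τ := (hpre τ le_rfl).symm
    have e₂ : p.getVert τ' = z.walk.getVert τ'' := by rw [← add_zero τ'', hsuf 0, add_zero]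
    have hq : ∀ m, (β.copy e₁ e₂).getVert m = z.walk.getVert (τ + min m (τ'' - τ)) := fun m => by
      rw [SimpleGraph.Walk.getVert_copy, hz, getVert_take_append_append_drop p hττ' hτ'L β, if_neg (by omega),
        if_pos (by omega), Nat.add_sub_cancel_left]
      rcases le_or_gt m (τ'' - τ) with hm | hm
      · rw [min_eq_left hm]
      · rw [min_eq_right hm.le, ← hβlen, SimpleGraph.Walk.getVert_length,
          SimpleGraph.Walk.getVert_of_length_le _ (by omega)]
    have hwin' := (hasSepWindows_window_iff (meshPoint δ) z.walk τ τ'' (β.copy e₁ e₂) hτ hτ''L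
      (by rw [SimpleGraph.Walk.length_copy, hβlen]) hq n y ρ R).1 hwin
    have hg : ∀ m, β'.walk.getVert m = (β.copy e₁ e₂).getVert m := fun m => by
      rw [getVert_eq_of_support_eq hsupp m, SimpleGraph.Walk.getVert_copy]
    rw [hasSepWindows_congr (meshPoint δ) hg, length_eq_of_support_eq hsupp,
      ← SimpleGraph.Walk.length_copy β e₁ e₂]
    exact hwin'
  -- assemble
  calc weight Ω δ a₀ b₀ _ ≤ weight Ω δ a₀ b₀ _ := measure_mono hsub
    _ ≤ ENNReal.ofReal ε * weight Ω δ a₀ b₀ _ :=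
        weight_le_ofReal_mul_weight hbeadT hbeadP (ExcursionDomination.weight_dom_univ_ne_top C'' hδ _ _) hlaw
    _ = ENNReal.ofReal ε * weight Ω δ a₀ b₀ _ := by rw [← hslot]

/-! ### The slot law -/

/-- **Registered stub `stub_slotLaw`** (crux stmt-CriticalPhenomena-1878, line `slit-necklace`, reshape r4):
the SLOT LAW `SlotLaw` of `…SlitNecklaceFarTip` — hung presentation + engine ⇒ for every `ε > 0` and allowance
`n₀`, the threshold `n` of `UniformSubshellTight ε (2 n₀ + 1)` makes the event "the `J`-th far-tip piece of the
critical chord has `n` strictly separated windows across `D(y; ρ, R)` between its far tips AND a far-tip witness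
with fewer than `n₀ + 1` windows across `D(y; s₁, s₂)`" have probability `≤ ε`, uniformly in the tame-presented
domain, the attached spine, the shell and `J`.  Canonical slots (S1) are pairwise disjoint of total weight `≤ Z`;
each is charged `ε` times its weight (S2/S3, `weight_slotEvent_le`); `law = Z⁻¹ · weight`. [folklore] -/
theorem stub_slotLaw : SlotLaw := by
  intro hHP hUST ε hε n₀
  obtain ⟨n, hn⟩ := hUST ε hε (2 * n₀ + 1)
  refine ⟨n, ?_⟩
  intro D δ c C S Ka Kb a₀ b₀ ca cb η y ρ R s₁ s₂ J hδ hS hatt ha₀ hb₀ hρ hρR hs₁ hs₁₂ hs₂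
  classical
  set Sp : Set (Site 2) := (↑(Ka ∪ Kb ∪ S) : Set (Site 2)) with hSp
  -- the far-tip data, their count, the slot in index form
  let FT : DomainSAW D.carrier δ a₀ b₀ → ℕ → ℕ → ℕ → ℕ → Prop := fun γ i j τ τ' =>
    IsFarTipPiece (meshPoint δ) γ.walk Sp i j τ τ' ca cb η
  let cnt : DomainSAW D.carrier δ a₀ b₀ → ℕ → ℕ := fun γ i =>
    {i' : ℕ | i' < i ∧ ∃ j' τ₁ τ₁', IsFarTipPiece (meshPoint δ) γ.walk Sp i' j' τ₁ τ₁' ca cb η}.ncard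
  let InSlot : DomainSAW D.carrier δ a₀ b₀ → ℕ → ℕ → DomainSAW D.carrier δ a₀ b₀ → Prop := fun γ τ τ' z =>
    (∀ m, m ≤ τ → z.walk.getVert m = γ.walk.getVert m) ∧
      ∃ τ'', τ ≤ τ'' ∧ τ'' ≤ z.walk.length ∧ z.walk.length + τ' = γ.walk.length + τ'' ∧
        (∀ m, z.walk.getVert (τ'' + m) = γ.walk.getVert (τ' + m)) ∧ ∀ m, τ ≤ m → m ≤ τ'' → z.walk.getVert m ∉ Sp
  let Sl : DomainSAW D.carrier δ a₀ b₀ → Set (DomainSAW D.carrier δ a₀ b₀) := fun γ =>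
    {z | ∃ i j τ τ', FT γ i j τ τ' ∧ cnt γ i = J ∧ InSlot γ τ τ' z}
  set E : Set (DomainSAW D.carrier δ a₀ b₀) := {γ | ∃ i j τ τ' : ℕ,
    IsFarTipPiece (meshPoint δ) γ.walk Sp i j τ τ' ca cb η ∧
    {i' : ℕ | i' < i ∧ ∃ j' τ₁ τ₁', IsFarTipPiece (meshPoint δ) γ.walk Sp i' j' τ₁ τ₁' ca cb η}.ncard = J ∧
    HasSepWindows (meshPoint δ) γ.walk n τ τ' y ρ R ∧
    HasFarTipWitness D.carrier δ Sp γ.walk τ τ' (n₀ + 1) y s₁ s₂} with hE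
  -- S1: uniqueness of the data and its transfer to the slot
  have huniq : ∀ {γ : DomainSAW D.carrier δ a₀ b₀} {i₁ j₁ τ₁ τ₁' i₂ j₂ τ₂ τ₂' : ℕ},
      FT γ i₁ j₁ τ₁ τ₁' → cnt γ i₁ = J → FT γ i₂ j₂ τ₂ τ₂' → cnt γ i₂ = J →
      i₁ = i₂ ∧ j₁ = j₂ ∧ τ₁ = τ₂ ∧ τ₁' = τ₂' :=
    fun h₁ hJ₁ h₂ hJ₂ => farTipData_unique h₁ hJ₁ h₂ hJ₂
  have htrans : ∀ {γ z : DomainSAW D.carrier δ a₀ b₀} {i j τ τ' τ'' : ℕ}, FT γ i j τ τ' → cnt γ i = J →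
      (∀ m, m ≤ τ → z.walk.getVert m = γ.walk.getVert m) → τ ≤ τ'' → τ'' ≤ z.walk.length →
      z.walk.length + τ' = γ.walk.length + τ'' → (∀ m, z.walk.getVert (τ'' + m) = γ.walk.getVert (τ' + m)) →
      (∀ m, τ ≤ m → m ≤ τ'' → z.walk.getVert m ∉ Sp) → FT z i (j + τ'' - τ') τ τ'' ∧ cnt z i = J := by
    intro γ z i j τ τ' τ'' hft hJ hpre hτ hτ''L hlen hsuf hmid
    refine ⟨hft.slot_transfer hpre hτ hτ''L hlen hsuf hmid, ?_⟩
    have hiτ := hft.2.1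
    show {i' : ℕ | i' < i ∧ ∃ j' τ₁ τ₁', IsFarTipPiece (meshPoint δ) z.walk Sp i' j' τ₁ τ₁' ca cb η}.ncard = J
    rw [setOf_earlier_farTipPiece_eq hft.1.1 (by omega) fun m hm => hpre m (by omega)]
    exact hJ
  have hSl : ∀ {γ : DomainSAW D.carrier δ a₀ b₀} {i j τ τ' : ℕ}, FT γ i j τ τ' → cnt γ i = J →
      Sl γ = {z | InSlot γ τ τ' z} := by
    intro γ i j τ τ' hft hJ
    ext z
    constructor
    · rintro ⟨i₁, j₁, τ₁, τ₁', h₁, hJ₁, hz⟩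
      obtain ⟨-, -, h₃, h₄⟩ := huniq hft hJ h₁ hJ₁
      subst h₃ h₄
      exact hz
    · exact fun hz => ⟨i, j, τ, τ', hft, hJ, hz⟩
  -- (a) every chord of `E` lies in its slot; (b) the slot of a member is the slot; (c) the slot bound
  have ha : ∀ γ ∈ E, γ ∈ Sl γ := by
    rintro γ ⟨i, j, τ, τ', hft, hJ, -, -⟩
    exact ⟨i, j, τ, τ', hft, hJ, hft.inSlot_self⟩
  have hb : ∀ γ ∈ E, ∀ z ∈ Sl γ, Sl z = Sl γ := by
    rintro γ ⟨i, j, τ, τ', hft, hJ, -, -⟩ z hz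
    rw [hSl hft hJ] at hz ⊢
    obtain ⟨hpre, τ'', hτ, hτ''L, hlen, hsuf, hmid⟩ := hz
    obtain ⟨hftz, hJz⟩ := htrans hft hJ hpre hτ hτ''L hlen hsuf hmid
    rw [hSl hftz hJz]
    ext w
    exact inSlot_congr hpre hlen hsuf
  have hc : ∀ γ ∈ E, weight D.carrier δ a₀ b₀ (E ∩ Sl γ) ≤
      ENNReal.ofReal ε * weight D.carrier δ a₀ b₀ (Sl γ) := by
    rintro γ ⟨i, j, τ, τ', hft, hJ, -, hwit⟩
    rw [hSl hft hJ]
    refine (measure_mono ?_).trans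
      (weight_slotEvent_le hHP hn hδ hS hatt ha₀ hb₀ hρ hρR hs₁ hs₁₂ hs₂ hft hwit)
    rintro z ⟨⟨i₃, j₃, τ₃, τ₃', hft₃, hJ₃, hwin₃, -⟩, hpre, τ'', hτ, hτ''L, hlen, hsuf, hmid⟩
    obtain ⟨hftz, hJz⟩ := htrans hft hJ hpre hτ hτ''L hlen hsuf hmid
    obtain ⟨-, -, h₃, h₄⟩ := huniq hftz hJz hft₃ hJ₃
    subst h₃ h₄
    exact ⟨hpre, τ'', hτ, hτ''L, hlen, hsuf, hmid, hwin₃⟩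
  -- the finitely many slots
  haveI : Finite (DomainSAW D.carrier δ a₀ b₀) :=
    SAWLoopFugacityFlowAssembly.finite_domainSAW D.isBounded hδ a₀ b₀
  haveI : Fintype (DomainSAW D.carrier δ a₀ b₀) := Fintype.ofFinite _
  set 𝒯 : Finset (Set (DomainSAW D.carrier δ a₀ b₀)) := (Finset.univ.filter fun γ => γ ∈ E).image Sl with h𝒯
  have hmemT : ∀ {T}, T ∈ 𝒯 → ∃ γ ∈ E, Sl γ = T := fun hT => by
    obtain ⟨γ, hγ, rfl⟩ := Finset.mem_image.1 hT
    exact ⟨γ, (Finset.mem_filter.1 hγ).2, rfl⟩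
  have hcover : E ⊆ ⋃ T ∈ 𝒯, E ∩ T := fun γ hγ =>
    Set.mem_iUnion₂.2 ⟨Sl γ, Finset.mem_image_of_mem Sl (Finset.mem_filter.2 ⟨Finset.mem_univ _, hγ⟩),
      hγ, ha γ hγ⟩
  have hdisj : (↑𝒯 : Set (Set (DomainSAW D.carrier δ a₀ b₀))).PairwiseDisjoint (fun T => T) := by
    intro T₁ hT₁ T₂ hT₂ hne
    obtain ⟨γ₁, hγ₁, rfl⟩ := hmemT (Finset.mem_coe.1 hT₁)
    obtain ⟨γ₂, hγ₂, rfl⟩ := hmemT (Finset.mem_coe.1 hT₂)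
    exact Set.disjoint_left.2 fun z hz₁ hz₂ => hne ((hb γ₁ hγ₁ z hz₁).symm.trans (hb γ₂ hγ₂ z hz₂))
  have hsum : ∑ T ∈ 𝒯, weight D.carrier δ a₀ b₀ T = weight D.carrier δ a₀ b₀ (⋃ T ∈ 𝒯, T) :=
    (measure_biUnion_finset hdisj fun T _ => MeasurableSpace.measurableSet_top).symm
  have hwE : weight D.carrier δ a₀ b₀ E ≤ ENNReal.ofReal ε * weight D.carrier δ a₀ b₀ Set.univ :=
    calc weight D.carrier δ a₀ b₀ E ≤ weight D.carrier δ a₀ b₀ (⋃ T ∈ 𝒯, E ∩ T) := measure_mono hcover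
      _ ≤ ∑ T ∈ 𝒯, weight D.carrier δ a₀ b₀ (E ∩ T) := measure_biUnion_finset_le 𝒯 _
      _ ≤ ∑ T ∈ 𝒯, ENNReal.ofReal ε * weight D.carrier δ a₀ b₀ T :=
          Finset.sum_le_sum fun T hT => by
            obtain ⟨γ, hγ, rfl⟩ := hmemT hT
            exact hc γ hγ
      _ = ENNReal.ofReal ε * weight D.carrier δ a₀ b₀ (⋃ T ∈ 𝒯, T) := by rw [← Finset.mul_sum, hsum]
      _ ≤ ENNReal.ofReal ε * weight D.carrier δ a₀ b₀ Set.univ := by gcongr; exact Set.subset_univ _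
  rw [law, Measure.smul_apply, smul_eq_mul]
  calc (weight D.carrier δ a₀ b₀ Set.univ)⁻¹ * weight D.carrier δ a₀ b₀ E
      ≤ (weight D.carrier δ a₀ b₀ Set.univ)⁻¹ * (ENNReal.ofReal ε * weight D.carrier δ a₀ b₀ Set.univ) := by
        gcongr
    _ = ENNReal.ofReal ε * ((weight D.carrier δ a₀ b₀ Set.univ)⁻¹ * weight D.carrier δ a₀ b₀ Set.univ) := by
        ring
    _ ≤ ENNReal.ofReal ε * 1 := by gcongr; exact ENNReal.inv_mul_le_one _
    _ = ENNReal.ofReal ε := mul_one _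

end Summit.CriticalPhenomena.SAWScalingLimit.Theorems.FKGToTraversalBound.SlitNecklace

end
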